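import Mathlib
import Literature.NumberTheory.LFunctions.Zhang2022.GaussKernelContour
import HarnessLib

/-!
# Zhang (2022) §15 (15.15)–(15.16): the poles of the integrand of §15.u036 inside Landau's rectangle
# (pole data for the residue theorem, abstract in the Euler-product factor `ℳ₁`)

Topic `Literature/NumberTheory/LFunctions/Zhang2022` (Landau–Siegel audit tree; verdict-neutral).
Y. Zhang, *Discrete mean estimates and the Landau–Siegel zero*, arXiv:2211.02515v1 (2022)
[Zhang2022LandauSiegel] — **an unrefereed manuscript under adjudication**; nothing here is a claim
of the manuscript. This file is the character-free / `ℳ₁`-free complex analysis behind the display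
(15.15) [Z22 p.85, tex L4218–4224]: "In a way similar to the proof of Lemma 8.4, we deduce that
`𝒟₁(d,l) = λ₁(d)Σ_{j≤3} ℛ_{1j}d^{β_j}ℳ₁(d,l;1−β_j) + O(ε₁)`, where `ℛ_{1j}` denotes the residue of the
function (15.16) at `s = −β_j` … (15.16) also has a simple pole at `s = ρ̃ − 1`, while the residue at
this point can be regarded as an acceptable error". The integrand of §15.u036 is `G = Φ·K` with the
Gaussian Perron kernel `K(s) = Y^{s+β}ω₁(s+β)/(s+β)` of `GaussKernelContour` (`Y = P₄/d`, `β = β₃`,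
`Λ = 𝓛³⁰`) and `Φ(s) = ζ(1+s+β_a)ζ(1+s+β_b)M(1+s)c/(ζ(1+s)L(1+s,χ))` (`β_a, β_b = β₁, β₂`,
`M = ℳ₁(d,l;·)`, `c = d^{β₃}`). For ABSTRACT `M` (holomorphic on `σ > 9/10`), `c`, `β`'s and an
abstract real zero `ρ` of `L(s,χ)`, and for `Φ` given in the REGULARISED form
`Φ(s) = ζ(1+s+β_a)ζ(1+s+β_b)M(1+s)·c·s/(ζ₁(1+s)L(1+s,χ))` (Mathlib's entire `ζ₁(w) = (w−1)ζ(w)`;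
equal to the printed quotient off `s = 0`, `Phi_eq_of_ne_zero`, and holomorphic across `s = 0`):

* `differentiableOn_G` — `G` is holomorphic off the four points `−β_a, −β_b, −β, ρ − 1` wherever
  `ζ₁(1+z) ≠ 0`, `Re(1+z) > 9/10`, and `L(1+z,χ) ≠ 0` for `z ≠ ρ − 1`;
* the four SIMPLE POLES in the format of the tree's residue theorem
  (`Literature.Analysis.Complex.rectBoundaryIntegral_eq_sum_of_poles`, consumed through
  `GaussKernelContour.norm_lineIntegral_sub_residues_le_of_simplePoles`): an open `V ∋ p` and an
  explicit `φ_p` holomorphic on `V` with `G = φ_p/(z − p)` on `V ∖ {p}` — `pole_at_neg_betaA` (and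
  `…_betaB` by symmetry), `pole_at_neg_beta` (the kernel's pole), `pole_at_rho` (the exceptional zero,
  via Mathlib's `dslope`).

Zero-free regions, the location of `ρ`, and all sizes are hypotheses, discharged by the consumer
(`Section15BEq1515Ranged`). [cite: Zhang2022LandauSiegel, §15 (15.15)–(15.16) p.85]

## References
* Y. Zhang, arXiv:2211.02515v1 (2022), §15 (15.15)–(15.16) p.85. [cite: Zhang2022LandauSiegel, §15 (15.15)]
* J. B. Conway, *Functions of One Complex Variable I*, GTM 11, Ch. V Thm 2.2. [Conway1978]
-/

noncomputable section

open Complex Real Set Filter Topology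

namespace Literature.NumberTheory.LFunctions.Zhang2022.Eq1515

open Literature.NumberTheory.LFunctions.Zhang2022.GaussWeight

variable {D : ℕ} [NeZero D] (χ : DirichletCharacter ℂ D)
variable (Φ M : ℂ → ℂ) (cst βa βb β : ℂ) {Y : ℝ} (Λ : ℝ)

/-! ### The regularised `Φ` and the integrand `G = Φ·K` -/

/-- Off `s = 0` the regularised `Φ` is the printed quotient
`ζ(1+s+β_a)ζ(1+s+β_b)M(1+s)c/(ζ(1+s)L(1+s,χ))` (`ζ(1+s) = s⁻¹ζ₁(1+s)`).
[cite: Zhang2022LandauSiegel, §15 (15.16) p.85] -/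
theorem Phi_eq_of_ne_zero
    (hΦ : ∀ s, Φ s = riemannZeta (1 + s + βa) * riemannZeta (1 + s + βb) * M (1 + s) * cst * s /
      (riemannZeta₁ (1 + s) * χ.LFunction (1 + s)))
    {s : ℂ} (hs : s ≠ 0) :
    Φ s = riemannZeta (1 + s + βa) * riemannZeta (1 + s + βb) * M (1 + s) /
        (riemannZeta (1 + s) * χ.LFunction (1 + s)) * cst := by
  have h1 : (1 : ℂ) + s ≠ 1 := by intro h; apply hs; linear_combination h
  rw [hΦ, riemannZeta_eq_inv_sub_mul h1, add_sub_cancel_left]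
  have hs' : (s : ℂ)⁻¹ ≠ 0 := inv_ne_zero hs
  field_simp

/-! ### Holomorphy off the poles -/

/-- The "regular set": `ζ₁(1+z) ≠ 0`, `L(1+z,χ) ≠ 0`, `Re(1+z) > 9/10`; it is open. [folklore] -/
private theorem isOpen_regSet (hχ1 : χ ≠ 1) :
    IsOpen {z : ℂ | riemannZeta₁ (1 + z) ≠ 0 ∧ χ.LFunction (1 + z) ≠ 0 ∧ 9 / 10 < (1 + z).re} := by
  have h1 : Continuous fun z : ℂ => riemannZeta₁ (1 + z) :=
    differentiable_riemannZeta₁.continuous.comp (by fun_prop)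
  have h2 : Continuous fun z : ℂ => χ.LFunction (1 + z) :=
    (DirichletCharacter.differentiable_LFunction hχ1).continuous.comp (by fun_prop)
  have h3 : Continuous fun z : ℂ => (1 + z).re := Complex.continuous_re.comp (by fun_prop)
  rw [Set.setOf_and, Set.setOf_and]
  exact (isOpen_ne_fun h1 continuous_const).inter ((isOpen_ne_fun h2 continuous_const).inter
    (isOpen_lt continuous_const h3))

/-- Differentiability of the regular factor `z ↦ M(1+z)·c·z/(ζ₁(1+z)·F(1+z))` at a point where
`ζ₁(1+z) ≠ 0`, `F(1+z) ≠ 0`, `Re(1+z) > 9/10` (`F = L(·,χ)` or its `dslope` at `ρ`). [folklore] -/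
private theorem differentiableAt_regFactor (F : ℂ → ℂ) (hF : Differentiable ℂ F)
    (hMd : DifferentiableOn ℂ M {w : ℂ | 9 / 10 < w.re}) {z : ℂ}
    (hz : riemannZeta₁ (1 + z) ≠ 0 ∧ F (1 + z) ≠ 0 ∧ 9 / 10 < (1 + z).re) :
    DifferentiableAt ℂ (fun z : ℂ => M (1 + z) * cst * z / (riemannZeta₁ (1 + z) * F (1 + z))) z := by
  have hopen : IsOpen {w : ℂ | 9 / 10 < w.re} := isOpen_lt continuous_const Complex.continuous_re
  have hM : DifferentiableAt ℂ (fun z : ℂ => M (1 + z)) z :=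
    (hMd.differentiableAt (hopen.mem_nhds hz.2.2)).comp z (by fun_prop)
  have hζ1 : DifferentiableAt ℂ (fun z : ℂ => riemannZeta₁ (1 + z)) z :=
    (differentiable_riemannZeta₁ _).comp z (by fun_prop)
  have hL : DifferentiableAt ℂ (fun z : ℂ => F (1 + z)) z := (hF _).comp z (by fun_prop)
  exact ((hM.mul_const cst).mul differentiableAt_id).div (hζ1.mul hL) (mul_ne_zero hz.1 hz.2.1)

/-- `z ↦ ζ(1+z+γ)` is differentiable at `z ≠ −γ`. [folklore] -/
private theorem differentiableAt_zeta_shift (γ : ℂ) {z : ℂ} (hz : z ≠ -γ) :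
    DifferentiableAt ℂ (fun z : ℂ => riemannZeta (1 + z + γ)) z := by
  have h1 : (1 : ℂ) + z + γ ≠ 1 := by
    intro h; apply hz; linear_combination h
  exact (differentiableAt_riemannZeta h1).comp z (by fun_prop)

/-- `z ↦ ζ₁(1+z+γ)` is entire. [folklore] -/
private theorem differentiable_zeta1_shift (γ : ℂ) :
    Differentiable ℂ (fun z : ℂ => riemannZeta₁ (1 + z + γ)) :=
  differentiable_riemannZeta₁.comp (by fun_prop)

/-- **`G = Φ·K` is holomorphic off the four points** `−β_a, −β_b, −β, ρ−1`, on any set `U` where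
`ζ₁(1+z) ≠ 0`, `Re(1+z) > 9/10`, and `L(1+z,χ) ≠ 0` for `z ≠ ρ − 1`.
[cite: Zhang2022LandauSiegel, §15 (15.15)–(15.16) p.85] -/
theorem differentiableOn_G (hχ1 : χ ≠ 1) (hMd : DifferentiableOn ℂ M {w : ℂ | 9 / 10 < w.re})
    (hY : 0 < Y)
    (hΦ : ∀ s, Φ s = riemannZeta (1 + s + βa) * riemannZeta (1 + s + βb) * M (1 + s) * cst * s /
      (riemannZeta₁ (1 + s) * χ.LFunction (1 + s)))
    (ρ : ℝ) (U : Set ℂ)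
    (hUζ : ∀ z ∈ U, riemannZeta₁ (1 + z) ≠ 0) (hUre : ∀ z ∈ U, 9 / 10 < (1 + z).re)
    (hUL : ∀ z ∈ U, z ≠ ((ρ - 1 : ℝ) : ℂ) → χ.LFunction (1 + z) ≠ 0) :
    DifferentiableOn ℂ (fun s => Φ s * ((Y : ℂ) ^ (s + β) * omega1 Λ (s + β) / (s + β)))
      (U \ ↑({-βa, -βb, -β, ((ρ - 1 : ℝ) : ℂ)} : Finset ℂ)) := by
  intro z hz
  obtain ⟨hzU, hzS⟩ := hz
  simp only [Finset.coe_insert, Finset.coe_singleton, Set.mem_insert_iff, Set.mem_singleton_iff,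
    not_or] at hzS
  obtain ⟨hza, hzb, hzβ, hzρ⟩ := hzS
  refine DifferentiableAt.differentiableWithinAt ?_
  have hreg := differentiableAt_regFactor M cst _ (DirichletCharacter.differentiable_LFunction hχ1)
    hMd ⟨hUζ z hzU, hUL z hzU hzρ, hUre z hzU⟩
  have ha := differentiableAt_zeta_shift βa hza
  have hb := differentiableAt_zeta_shift βb hzb
  have hK := GaussKernelContour.differentiableAt_kernel hY Λ (β := β) (s := z)
    (by intro h; apply hzβ; linear_combination h)
  have hGeq : (fun s => Φ s * ((Y : ℂ) ^ (s + β) * omega1 Λ (s + β) / (s + β))) =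
      fun z => riemannZeta (1 + z + βa) * riemannZeta (1 + z + βb) *
      (M (1 + z) * cst * z / (riemannZeta₁ (1 + z) * χ.LFunction (1 + z))) *
      ((Y : ℂ) ^ (z + β) * omega1 Λ (z + β) / (z + β)) := by
    funext w; rw [hΦ w]; ring
  rw [hGeq]
  exact ((ha.mul hb).mul hreg).mul hK

/-! ### The simple pole at `−β_a` (and, by symmetry, at `−β_b`) -/

set_option maxHeartbeats 400000 in
/-- **The pole of `G` at `s = −β_a`** (from `ζ(1+s+β_a)`; (15.16): "`ℛ_{1j}` denotes the residue … at
`s = −β_j`"): on the open set `V = {ζ₁(1+z) ≠ 0, L(1+z,χ) ≠ 0, Re(1+z) > 9/10, z ≠ −β_b, z ≠ −β}`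
(which contains `−β_a` when `ζ₁(1−β_a) ≠ 0`, `L(1−β_a,χ) ≠ 0`, `Re β_a < 1/10`, `β_a ≠ β_b`, `β_a ≠ β`),
`G(z) = φ_a(z)/(z + β_a)` with the holomorphic
`φ_a(z) = ζ₁(1+z+β_a)ζ(1+z+β_b)·M(1+z)cz/(ζ₁(1+z)L(1+z,χ))·K(z)`.
[cite: Zhang2022LandauSiegel, §15 (15.16) p.85] -/
theorem pole_at_neg_betaA (hχ1 : χ ≠ 1) (hMd : DifferentiableOn ℂ M {w : ℂ | 9 / 10 < w.re})
    (hY : 0 < Y)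
    (hΦ : ∀ s, Φ s = riemannZeta (1 + s + βa) * riemannZeta (1 + s + βb) * M (1 + s) * cst * s /
      (riemannZeta₁ (1 + s) * χ.LFunction (1 + s)))
    (hζa : riemannZeta₁ (1 - βa) ≠ 0) (hLa : χ.LFunction (1 - βa) ≠ 0) (hrea : βa.re < 1 / 10)
    (hab : βa ≠ βb) (haβ : βa ≠ β) :
    ∃ V ∈ 𝓝 (-βa), DifferentiableOn ℂ (fun z : ℂ => riemannZeta₁ (1 + z + βa) *
        riemannZeta (1 + z + βb) * (M (1 + z) * cst * z / (riemannZeta₁ (1 + z) * χ.LFunction (1 + z))) *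
        ((Y : ℂ) ^ (z + β) * omega1 Λ (z + β))/ (z + β)) V ∧
      ∀ z ∈ V, z ≠ -βa → Φ z * ((Y : ℂ) ^ (z + β) * omega1 Λ (z + β) / (z + β)) =
        (riemannZeta₁ (1 + z + βa) *
        riemannZeta (1 + z + βb) * (M (1 + z) * cst * z / (riemannZeta₁ (1 + z) * χ.LFunction (1 + z))) *
        ((Y : ℂ) ^ (z + β) * omega1 Λ (z + β)) / (z + β)) / (z - (-βa)) := by
  set V : Set ℂ := {z : ℂ | riemannZeta₁ (1 + z) ≠ 0 ∧ χ.LFunction (1 + z) ≠ 0 ∧ 9 / 10 < (1 + z).re} ∩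
    ({z : ℂ | z ≠ -βb} ∩ {z : ℂ | z ≠ -β}) with hV
  have hVopen : IsOpen V :=
    (isOpen_regSet χ hχ1).inter ((isOpen_ne_fun continuous_id continuous_const).inter
      (isOpen_ne_fun continuous_id continuous_const))
  have hmem : -βa ∈ V := by
    refine ⟨⟨?_, ?_, ?_⟩, ?_, ?_⟩
    · simpa [sub_eq_add_neg] using hζa
    · simpa [sub_eq_add_neg] using hLa
    · simp; linarith
    · intro h; exact hab (neg_injective h)
    · intro h; exact haβ (neg_injective h)
  refine ⟨V, hVopen.mem_nhds hmem, ?_, ?_⟩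
  · intro z hz
    obtain ⟨hzreg, hzb, hzβ⟩ := hz
    refine DifferentiableAt.differentiableWithinAt ?_
    have hreg := differentiableAt_regFactor M cst _ (DirichletCharacter.differentiable_LFunction hχ1)
      hMd hzreg
    have ha := differentiable_zeta1_shift βa z
    have hb := differentiableAt_zeta_shift βb hzb
    have hnum := GaussKernelContour.differentiable_kernel_num hY Λ β z
    have hzβ' : z + β ≠ 0 := by intro h; apply hzβ; linear_combination h
    exact (((ha.mul hb).mul hreg).mul hnum).div (differentiableAt_id.add_const β) hzβ'
  · intro z hz hza
    have hza' : z + βa ≠ 0 := by intro h; apply hza; linear_combination h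
    have h1 : (1 : ℂ) + z + βa ≠ 1 := by intro h; apply hza'; linear_combination h
    rw [hΦ z, riemannZeta_eq_inv_sub_mul h1, show (1 : ℂ) + z + βa - 1 = z + βa by ring,
      sub_neg_eq_add]
    field_simp

/-! ### The simple pole at `−β` (the kernel's pole) -/

/-- **The pole of `G` at `s = −β`** (from the kernel `Y^{s+β}ω₁(s+β)/(s+β)`; in (15.15) `β = β₃` and
the residue is `ℛ₁₃·…`): on `V = {ζ₁(1+z) ≠ 0, L(1+z,χ) ≠ 0, Re(1+z) > 9/10, z ≠ −β_a, z ≠ −β_b}`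
(contains `−β` when `ζ₁(1−β) ≠ 0`, `L(1−β,χ) ≠ 0`, `Re β < 1/10`, `β ≠ β_a`, `β ≠ β_b`),
`G(z) = φ(z)/(z + β)` with `φ(z) = Φ(z)·Y^{z+β}ω₁(z+β)` holomorphic on `V`.
[cite: Zhang2022LandauSiegel, §15 (15.16) p.85] -/
theorem pole_at_neg_beta (hχ1 : χ ≠ 1) (hMd : DifferentiableOn ℂ M {w : ℂ | 9 / 10 < w.re})
    (hY : 0 < Y)
    (hΦ : ∀ s, Φ s = riemannZeta (1 + s + βa) * riemannZeta (1 + s + βb) * M (1 + s) * cst * s /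
      (riemannZeta₁ (1 + s) * χ.LFunction (1 + s)))
    (hζ : riemannZeta₁ (1 - β) ≠ 0) (hL : χ.LFunction (1 - β) ≠ 0) (hre : β.re < 1 / 10)
    (hβa : β ≠ βa) (hβb : β ≠ βb) :
    ∃ V ∈ 𝓝 (-β), DifferentiableOn ℂ (fun z : ℂ => Φ z * ((Y : ℂ) ^ (z + β) * omega1 Λ (z + β))) V ∧
      ∀ z ∈ V, z ≠ -β → Φ z * ((Y : ℂ) ^ (z + β) * omega1 Λ (z + β) / (z + β)) =
        Φ z * ((Y : ℂ) ^ (z + β) * omega1 Λ (z + β)) / (z - (-β)) := by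
  set V : Set ℂ := {z : ℂ | riemannZeta₁ (1 + z) ≠ 0 ∧ χ.LFunction (1 + z) ≠ 0 ∧ 9 / 10 < (1 + z).re} ∩
    ({z : ℂ | z ≠ -βa} ∩ {z : ℂ | z ≠ -βb}) with hV
  have hVopen : IsOpen V :=
    (isOpen_regSet χ hχ1).inter ((isOpen_ne_fun continuous_id continuous_const).inter
      (isOpen_ne_fun continuous_id continuous_const))
  have hmem : -β ∈ V := by
    refine ⟨⟨?_, ?_, ?_⟩, ?_, ?_⟩
    · simpa [sub_eq_add_neg] using hζ
    · simpa [sub_eq_add_neg] using hL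
    · simp; linarith
    · intro h; exact hβa (neg_injective h)
    · intro h; exact hβb (neg_injective h)
  refine ⟨V, hVopen.mem_nhds hmem, ?_, ?_⟩
  · intro z hz
    obtain ⟨hzreg, hza, hzb⟩ := hz
    refine DifferentiableAt.differentiableWithinAt ?_
    have hreg := differentiableAt_regFactor M cst _ (DirichletCharacter.differentiable_LFunction hχ1)
      hMd hzreg
    have ha := differentiableAt_zeta_shift βa hza
    have hb := differentiableAt_zeta_shift βb hzb
    have hnum := GaussKernelContour.differentiable_kernel_num hY Λ β z
    have hΦeq : Φ = fun z => riemannZeta (1 + z + βa) * riemannZeta (1 + z + βb) *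
        (M (1 + z) * cst * z / (riemannZeta₁ (1 + z) * χ.LFunction (1 + z))) := by
      funext w; rw [hΦ w]; ring
    rw [hΦeq]
    exact ((ha.mul hb).mul hreg).mul hnum
  · intro z _ _
    rw [sub_neg_eq_add]
    ring

/-! ### The simple pole at `ρ − 1` (the exceptional zero of `L(s,χ)`) -/

/-- Factoring the real zero `ρ` of `L(s,χ)`: `L(w,χ) = (w − ρ)ψ(w)` with `ψ = dslope L ρ` entire and
`ψ(ρ) = L′(ρ,χ)` (Mathlib `dslope`). [folklore] -/
private theorem LFunction_eq_sub_mul_dslope {ρ : ℝ} (hρ : χ.LFunction ρ = 0) (w : ℂ) :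
    χ.LFunction w = (w - ρ) * dslope (fun w => χ.LFunction w) ρ w := by
  have h := sub_smul_dslope (fun w => χ.LFunction w) (ρ : ℂ) w
  rw [smul_eq_mul, hρ, sub_zero] at h
  exact h.symm

/-- `dslope L ρ` is entire and its value at `ρ` is `L′(ρ,χ)`. [folklore] -/
private theorem differentiable_dslope_LFunction (hχ1 : χ ≠ 1) (ρ : ℝ) :
    Differentiable ℂ (dslope (fun w => χ.LFunction w) ρ) ∧
      dslope (fun w => χ.LFunction w) ρ ρ = deriv χ.LFunction ρ := by
  refine ⟨?_, dslope_same _ _⟩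
  have h : DifferentiableOn ℂ (dslope (fun w => χ.LFunction w) (ρ : ℂ)) Set.univ := by
    rw [differentiableOn_dslope (Filter.univ_mem)]
    exact (DirichletCharacter.differentiable_LFunction hχ1).differentiableOn
  exact fun u => h.differentiableAt (Filter.univ_mem)

/-- **The pole of `G` at `s = ρ − 1`** ((15.15): "(15.16) also has a simple pole at `s = ρ̃ − 1`"): with
`ψ = dslope L ρ` (so `L(1+z,χ) = (z − (ρ−1))ψ(1+z)`), on the open set
`V = {ζ₁(1+z) ≠ 0, ψ(1+z) ≠ 0, Re(1+z) > 9/10, z ≠ −β_a, z ≠ −β_b, z ≠ −β}` (which contains `ρ − 1`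
when `L(ρ,χ) = 0 ≠ L′(ρ,χ)`, `ζ₁(ρ) ≠ 0`, `9/10 < ρ`, and `ρ − 1` is none of `−β_a, −β_b, −β`),
`G(z) = φ_ρ(z)/(z − (ρ−1))` with
`φ_ρ(z) = ζ(1+z+β_a)ζ(1+z+β_b)·M(1+z)cz/(ζ₁(1+z)ψ(1+z))·K(z)` holomorphic on `V`.
[cite: Zhang2022LandauSiegel, §15 (15.15) p.85] -/
theorem pole_at_rho (hχ1 : χ ≠ 1) (hMd : DifferentiableOn ℂ M {w : ℂ | 9 / 10 < w.re})
    (hY : 0 < Y)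
    (hΦ : ∀ s, Φ s = riemannZeta (1 + s + βa) * riemannZeta (1 + s + βb) * M (1 + s) * cst * s /
      (riemannZeta₁ (1 + s) * χ.LFunction (1 + s)))
    {ρ : ℝ} (hρ : χ.LFunction ρ = 0) (hρ' : deriv χ.LFunction ρ ≠ 0)
    (hζρ : riemannZeta₁ ρ ≠ 0) (hρre : 9 / 10 < ρ)
    (hρa : ((ρ - 1 : ℝ) : ℂ) ≠ -βa) (hρb : ((ρ - 1 : ℝ) : ℂ) ≠ -βb) (hρβ : ((ρ - 1 : ℝ) : ℂ) ≠ -β) :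
    ∃ V ∈ 𝓝 ((ρ - 1 : ℝ) : ℂ), DifferentiableOn ℂ (fun z : ℂ => riemannZeta (1 + z + βa) *
        riemannZeta (1 + z + βb) *
        (M (1 + z) * cst * z / (riemannZeta₁ (1 + z) * dslope (fun w => χ.LFunction w) ρ (1 + z))) *
        ((Y : ℂ) ^ (z + β) * omega1 Λ (z + β) / (z + β))) V ∧
      ∀ z ∈ V, z ≠ ((ρ - 1 : ℝ) : ℂ) → Φ z * ((Y : ℂ) ^ (z + β) * omega1 Λ (z + β) / (z + β)) =
        (riemannZeta (1 + z + βa) * riemannZeta (1 + z + βb) *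
        (M (1 + z) * cst * z / (riemannZeta₁ (1 + z) * dslope (fun w => χ.LFunction w) ρ (1 + z))) *
        ((Y : ℂ) ^ (z + β) * omega1 Λ (z + β) / (z + β))) / (z - ((ρ - 1 : ℝ) : ℂ)) := by
  set ψ : ℂ → ℂ := dslope (fun w => χ.LFunction w) ρ with hψ
  obtain ⟨hψd, hψρ⟩ := differentiable_dslope_LFunction χ hχ1 ρ
  set V : Set ℂ := {z : ℂ | riemannZeta₁ (1 + z) ≠ 0 ∧ ψ (1 + z) ≠ 0 ∧ 9 / 10 < (1 + z).re} ∩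
    ({z : ℂ | z ≠ -βa} ∩ ({z : ℂ | z ≠ -βb} ∩ {z : ℂ | z ≠ -β})) with hV
  have hVopen : IsOpen V := by
    have h1 : Continuous fun z : ℂ => riemannZeta₁ (1 + z) :=
      differentiable_riemannZeta₁.continuous.comp (by fun_prop)
    have h2 : Continuous fun z : ℂ => ψ (1 + z) := hψd.continuous.comp (by fun_prop)
    have h3 : Continuous fun z : ℂ => (1 + z).re := Complex.continuous_re.comp (by fun_prop)
    have hreg : IsOpen {z : ℂ | riemannZeta₁ (1 + z) ≠ 0 ∧ ψ (1 + z) ≠ 0 ∧ 9 / 10 < (1 + z).re} := by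
      rw [Set.setOf_and, Set.setOf_and]
      exact (isOpen_ne_fun h1 continuous_const).inter ((isOpen_ne_fun h2 continuous_const).inter
        (isOpen_lt continuous_const h3))
    exact hreg.inter ((isOpen_ne_fun continuous_id continuous_const).inter
      ((isOpen_ne_fun continuous_id continuous_const).inter
        (isOpen_ne_fun continuous_id continuous_const)))
  have h1ρ : (1 : ℂ) + ((ρ - 1 : ℝ) : ℂ) = (ρ : ℂ) := by push_cast; ring
  have hmem : ((ρ - 1 : ℝ) : ℂ) ∈ V := by
    refine ⟨⟨?_, ?_, ?_⟩, hρa, hρb, hρβ⟩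
    · rw [h1ρ]; exact hζρ
    · rw [h1ρ]; show ψ ρ ≠ 0; rw [hψ, hψρ]; exact hρ'
    · rw [h1ρ]; simpa using hρre
  refine ⟨V, hVopen.mem_nhds hmem, ?_, ?_⟩
  · intro z hz
    obtain ⟨hzreg, hza, hzb, hzβ⟩ := hz
    refine DifferentiableAt.differentiableWithinAt ?_
    have hreg := differentiableAt_regFactor M cst ψ hψd hMd hzreg
    have ha := differentiableAt_zeta_shift βa hza
    have hb := differentiableAt_zeta_shift βb hzb
    have hK := GaussKernelContour.differentiableAt_kernel hY Λ (β := β) (s := z)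
      (by intro h; apply hzβ; linear_combination h)
    exact ((ha.mul hb).mul hreg).mul hK
  · intro z hz hzρ
    obtain ⟨⟨hζ1, hψz, -⟩, -, -, -⟩ := hz
    have hsub : z - ((ρ - 1 : ℝ) : ℂ) ≠ 0 := sub_ne_zero.2 hzρ
    have hfac : χ.LFunction (1 + z) = (z - ((ρ - 1 : ℝ) : ℂ)) * ψ (1 + z) := by
      rw [LFunction_eq_sub_mul_dslope χ hρ (1 + z)]
      congr 1; push_cast; ring
    rw [hΦ z, hfac]
    field_simp

end Literature.NumberTheory.LFunctions.Zhang2022.Eq1515
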